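import Summits.AnomalousDissipation.AnomalousDissipation.Theses.RootDecompCycle2A

/-!
# Glue of the split of `RootDecompCycle2A.SpinUpRougheningTG` (stmt-AnomalousDissipation-25779)

Sorry-free proof of the GLUE item `RootDecompCycle2A.SpinUpRougheningTGGlue` (stmt-AnomalousDissipation-26827):
`SobolevRougheningTG → OnsagerWindowTG → SpinUpRougheningTG` — modus ponens (the window item is stated as the implication
from the Sobolev roughening to the parent).  No facts are asserted.
Source: decomp-ad cell, lens-2 g3 node «OnsagerWindow» (kernel `spinUpRoughening_of_split : fun hS hW => hW hS`); landed by the cell's prover seat.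
-/

set_option linter.dupNamespace false

namespace Summit.AnomalousDissipation.AnomalousDissipation.Theorems.SpinUpRougheningTGGlue

open Summit.AnomalousDissipation.AnomalousDissipation.Theses.RootDecompCycle2A

/-- The GLUE item `RootDecompCycle2A.SpinUpRougheningTGGlue` (stmt-AnomalousDissipation-26827) holds: modus ponens. [folklore] -/
theorem spinUpRougheningTGGlue_holds : SpinUpRougheningTGGlue :=
  fun hS hW => hW hS

end Summit.AnomalousDissipation.AnomalousDissipation.Theorems.SpinUpRougheningTGGlue
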